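import Literature.AlgebraicGeometry.PlaneCurves.HessePencilHarmonicPolars
import Literature.AlgebraicGeometry.PlaneCurves.HessePencilHessianGroup
import HarnessLib

/-!
# The translations of the Hesse pencil as incidences: `g₂ = (+p₁)`, `g₁⁻¹ = (+p₃)`, `g₀ = (−1)` (Artebani–Dolgachev §2, §4, §5)

Topic `Literature/AlgebraicGeometry/PlaneCurves`, namespace `Literature.AlgebraicGeometry.PlaneCurves`.
Lane `lit-hodgefound`, seat `lit-hodgefound-p37`, row g20-#2; a one-file sequel of
`HessePencilHessianGroup` (g18-#5: the generators `g₀, g₁, g₂` of the kernel `K ⊃ Γ` as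
substitutions; its docstring lists "the translations interpretation of `g₁, g₂`" as NOT there),
`HessePencilBasePoints` (Q2454: the induced permutations of the nine base points, `σ₂ = +(1,0)`,
`σ₁ = +(0,2)` on A–D's labels `𝔽₃²`) and `HessePencilHarmonicPolars` (Q2345: the polars at the
base points, `⟨∇H_μ(q), p⟩ = 3·L(q)·𝕋(q)`).  Everything here is PROVED (identities in the
coordinates of `ℙ²`); no definition, no named fact.

Source followed — M. Artebani, I. Dolgachev, *The Hesse pencil of plane cubic curves*,
L'Enseignement Math. (2) 55 (2009) 235–273 [arXiv:math/0611590, held `paper:arxiv-math_0611590`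
p0004 L5–L6, p0008 L9–L19, p0011 L1–L14], VERBATIM:

> (§2) Fixing one of the inflection points `p₀` defines a commutative group law `⊕` on `E` with
> `p₀` equal to the zero: `p ⊕ q` is the unique point `r` such that `p₀, r` and the third point of
> intersection in `p̄q̄ ∩ E` lie on a line.
> (§4) Its kernel `K` is generated by the transformations `g₀(x, y, z) = (x, z, y)`,
> `g₁(x, y, z) = (y, z, x)`, `g₂(x, y, z) = (x, εy, ε²z)` and contains a normal subgroup of index 2
> `Γ = ⟨g₁, g₂⟩ ≅ (ℤ/3ℤ)²`. If we use the group law with zero `p₀` on a nonsingular member of the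
> pencil, then `g₁` induces the translation by the 3-torsion point `p₃` and `g₂` that by the
> point `p₁`.
> (§5, proof of Prop. 5.2) The tangent line of `E` at `p = (x₀, y₀, z₀)` has the equation
> `(x₀² + ty₀z₀)x + (y₀² + tx₀z₀)y + (z₀² + tx₀y₀)z = 0`, where we assume that `E = E_{3t}`. The
> point `q = (x₀, εy₀, ε²z₀)` lies on `E` because `(x₀, y₀, z₀) ∈ E`, it also lies on the tangent
> line at `p` if `p = (x₀, y₀, z₀)` satisfies the equation `B₁ : x³ + εy³ + ε²z³ = 0`. If `p`
> satisfies this equation, then `q` also satisfies this equation, hence `r = (x₀, ε²y₀, εz₀)`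
> lies on the tangent at `q` and again satisfies (B1). Next time we repeat this procedure we get
> back to the original point `p`.

## What "induces the translation" means here, and the dictionary

With `p₀ = (0, 1, −1)` as zero, the printed recipe for `p ⊕ q` is an INCIDENCE statement: if `s`
is the third point of the line `p̄q̄` on `E`, then `p ⊕ q` is the third point of the line `p̄₀s̄`.
So "`g` induces the translation by the base point `t`" is witnessed, for every point `p` of the
plane, by a companion point `σ(p)` ON THE CURVE whenever `p` is (here `σ` is itself one of the
`216` projectivities of the pencil, an involution) such that

  `p, t, σ(p)` are collinear and `p₀, σ(p), g(p)` are collinear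

(`det = 0` of the three coordinate vectors), together with the TANGENCY facts that govern the
coincident cases (`σ(p) = p`: the line `p̄t̄` is the tangent at `p`, i.e. `⟨∇H_μ(p), t⟩ = 0`;
`σ(p) = g(p)`: the line through `p₀` is tangent at `σ(p)`), and the fact that the inflection
tangent at `t` meets the member only at `t` (so that `3t = 0`).  The group-theoretic conclusion
(`Φ(g p) = Φ(p) + Φ(t)` in the Mordell–Weil group of an elliptic Weierstrass model) is drawn in the
sequel `HessePencilGroupLaw`; this file is the coordinate geometry, valid over any field.

* `H_μ = X³ + Y³ + Z³ − 3μXYZ` (`𝐇[μ]`, the member `E_{3t}` of the source at `t = −μ`); `ε` is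
  an `ω` with `ω² + ω + 1 = 0` (or only `ω³ = 1` where that suffices); the base points
  `p₀ = (0, 1, −1)`, `p₁ = (0, 1, −ω)`, `p₂ = (0, 1, −ω²)`, `p₃ = (1, 0, −1)`, `p₆ = (1, −1, 0)`.
* Matrices act on coordinate vectors by `M *ᵥ p` (as in `HessePencilBasePoints`):
  `g₀ p = (x, z, y)`, `g₂ p = (x, ωy, ω²z)`, and `t₃ p = (z, x, y)` — the INVERSE of the printed
  `g₁(x, y, z) = (y, z, x)`; on points it is `t₃ = g₁⁻¹ = g₁²` that is the translation by `p₃`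
  (`g₁` itself is the translation by `p₆ = −p₃`, cf. `HessePencilBasePoints.affine_σ₁`:
  `σ₁ = +(0, 2)`), the usual point/coordinate convention clash, recorded not corrected.
* The companions: `σ₁ p = (x, ω²z, ωy)` for `g₂`, `σ₃ p = (z, y, x)` for `t₃`; for `g₀` (the
  negation `p ↦ −p`, "third point of `p̄₀p̄`") no companion is needed: `p₀, p, g₀ p` are collinear.
* "`q` lies on the tangent line at `p`" is `⟨∇H_μ(p), q⟩ = 0`.

## What is here (`K` a field; `p : Fin 3 → K` arbitrary unless said)

* §0 the maps written out (`mulVec_g₀`, `mulVec_g₁`, `mulVec_g₂`, `mulVec_t₃`, `mulVec_σ₁`,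
  `mulVec_σ₃`), `t₃ = g₁²`, `σ₁² = 1`, `σ₃² = 1` (`t₃_eq_g₁_sq_and_σ_sq`), `g₂³ = 1` on vectors
  (`g₂_pow_three_mulVec`), and every member is preserved pointwise:
  `hesse_eval_mulVec_g₀/g₂/t₃/σ₁/σ₃` (`H_μ(g p) = H_μ(p)`).
* §1 **`g₀ = (−1)`**: `det_p₀_p_g₀` (`p₀, p, g₀p` collinear for every `p`); the coincidence
  `mulVec_g₀_eq_smul` (`g₀ p ∥ p ≠ 0` forces `y = z` or `p ∥ p₀`) and its tangency
  `hesse_grad_dotProduct_p₀_of_eq` (`y = z ⇒ ⟨∇H_μ(p), p₀⟩ = 0`: the tangent at `p` passes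
  through `p₀`, `p` is `2`-torsion).
* §2 **`g₂ = (+p₁)`**: `det_p_p₁_σ₁` (`ω³ = 1`), `det_p₀_σ₁_g₂` (the two collinearities, for
  every `p`); `g₂_σ₁_mulVec_basePoints` (`g₂ p₀ = ω·p₁`, `σ₁ p₀ = −ω²·p₂`, `σ₁ p₁ = −p₁`); the
  coincidences `mulVec_σ₁_eq_smul` (`σ₁ p ∥ p ⇒ y = ω²z ∨ p ∥ p₁`),
  `mulVec_σ₁_eq_smul_mulVec_g₂` (`σ₁ p ∥ g₂ p ⇒ y = ωz ∨ p ∥ p₂`) and the matching tangencies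
  `hesse_grad_dotProduct_p₁_of_eq` (`y = ω²z ⇒ ⟨∇H_μ(p), p₁⟩ = 0`),
  `hesse_grad_σ₁_dotProduct_p₀_of_eq` (`y = ωz ⇒ ⟨∇H_μ(σ₁p), p₀⟩ = 0`).
* §3 **`t₃ = g₁⁻¹ = (+p₃)`**: `det_p_p₃_σ₃`, `det_p₀_σ₃_t₃`; `t₃_σ₃_mulVec_basePoints`
  (`t₃ p₀ = −p₃`, `σ₃ p₀ = −p₆`, `σ₃ p₃ = −p₃`, `g₁ p₀ = p₆`); the coincidences
  `mulVec_σ₃_eq_smul` (`σ₃ p ∥ p ⇒ x = z ∨ p ∥ p₃`), `mulVec_σ₃_eq_smul_mulVec_t₃`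
  (`σ₃ p ∥ t₃ p ⇒ x = y ∨ p ∥ p₆`) and tangencies `hesse_grad_dotProduct_p₃_of_eq`,
  `hesse_grad_σ₃_dotProduct_p₀_of_eq`.
* §4 **The inflection tangents at `p₀, p₁, p₃` meet a smooth member only there** (`μ³ ≠ 1`,
  `3 ≠ 0`): `hesse_inflectionTangent_meets_only_p₀/p₁/p₃` — on the tangent line the member restricts to
  `(1 − μ³)·x³` (resp. `(1 − μ³)·y³`).
* §5 **The printed tangent computation of §5**: `hesse_grad_dotProduct_g₂` —
  `⟨∇H_μ(p), g₂ p⟩ = 3·B₁(p)` with `B₁ = X³ + ωY³ + ω²Z³` ("`q = (x₀, εy₀, ε²z₀)` lies on the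
  tangent line at `p` iff `p` satisfies `B₁`"), `B₁_eval_mulVec_g₂` (`B₁(g₂ p) = B₁(p)`: "then `q`
  also satisfies this equation"), `g₂_pow_three_mulVec` ("we get back to the original point");
  and the same identity for ALL EIGHT non-trivial translations `g₂^a t₃^b`
  (`hesse_grad_dotProduct_translations`): the eight cubics `B₁, …, B₈` of Prop. 5.2 appear as
  `⟨∇H_μ(p), g₂^a t₃^b p⟩ = c_{a,b} · B_{i(a,b)}(p)` with `c = 3, 3, 3(1 − μ), 3(1 − μ),
  3(1 − ωμ), 3(1 − ω²μ), 3(1 − ω²μ), 3(1 − ωμ)` — non-zero on smooth members.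

NOT here: the group itself (the sequel `HessePencilGroupLaw` transports to an elliptic
Weierstrass model and proves `Φ(g₂p) = Φ(p) + Φ(p₁)`, `Φ(t₃p) = Φ(p) + Φ(p₃)`, `Φ(g₀p) = −Φ(p)`),
the points of order `9` (Prop. 5.2, first assertion — the row after), `S(3)` and its quotients.

## References
* [ArtebaniDolgachev2009] M. Artebani, I. Dolgachev, *The Hesse pencil of plane cubic curves*,
  Enseign. Math. (2) 55 (2009) 235–273, §2 (the group law with zero `p₀`), §4 (`g₁, g₂` as
  translations), §5 (proof of Prop. 5.2: the tangent at `p` and the point `(x₀, εy₀, ε²z₀)`).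
* [Kunz2005PlaneAlgebraicCurves] E. Kunz, *Introduction to Plane Algebraic Curves*, Birkhäuser
  2005, Ch. 10, Cor. 10.7 (three points of a line add up to `O`).
-/

set_option autoImplicit false

open MvPolynomial Matrix

namespace Literature.AlgebraicGeometry.PlaneCurves

universe u

/-- The Hesse cubic `H_μ = X³ + Y³ + Z³ − 3μXYZ` (local notation, no definition). -/
local notation3 "𝐇[" μ "]" =>
  (X 0 ^ 3 + X 1 ^ 3 + X 2 ^ 3 - C (3 * μ) * (X 0 * X 1 * X 2) : MvPolynomial (Fin 3) _)

/-- `B₁ = X³ + εY³ + ε²Z³` (local notation as in `HessePencilEightCubics`, no definition). -/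
local notation3 "𝐁₁[" ω "]" => (X 0 ^ 3 + C ω * X 1 ^ 3 + C (ω ^ 2) * X 2 ^ 3 : MvPolynomial (Fin 3) _)

/-- `g₀ = (x, z, y)` (local notation, no definition). -/
local notation3 "𝐠₀" => (Matrix.of ![![(1 : _), 0, 0], ![0, 0, 1], ![0, 1, 0]] : Matrix (Fin 3) (Fin 3) _)

/-- `g₁ = (y, z, x)` (local notation, no definition). -/
local notation3 "𝐠₁" => (Matrix.of ![![(0 : _), 1, 0], ![0, 0, 1], ![1, 0, 0]] : Matrix (Fin 3) (Fin 3) _)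

/-- `t₃ = g₁⁻¹ = (z, x, y)` on coordinate vectors (local notation, no definition). -/
local notation3 "𝐭₃" => (Matrix.of ![![(0 : _), 0, 1], ![1, 0, 0], ![0, 1, 0]] : Matrix (Fin 3) (Fin 3) _)

/-- `g₂ = diag(1, ε, ε²)` (local notation, no definition). -/
local notation3 "𝐠₂[" ω "]" =>
  (Matrix.of ![![(1 : _), 0, 0], ![0, ω, 0], ![0, 0, ω ^ 2]] : Matrix (Fin 3) (Fin 3) _)

/-- The companion involution of `g₂`: `σ₁ = (x, ω²z, ωy)` (local notation, no definition). -/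
local notation3 "𝛔₁[" ω "]" =>
  (Matrix.of ![![(1 : _), 0, 0], ![0, 0, ω ^ 2], ![0, ω, 0]] : Matrix (Fin 3) (Fin 3) _)

/-- The companion involution of `t₃`: `σ₃ = (z, y, x)` (local notation, no definition). -/
local notation3 "𝛔₃" => (Matrix.of ![![(0 : _), 0, 1], ![0, 1, 0], ![1, 0, 0]] : Matrix (Fin 3) (Fin 3) _)

section TranslationIncidences

variable {K : Type u} [Field K]

/-! ## §0 The maps on coordinate vectors; every member is preserved -/

/-- `g₀ (x, y, z) = (x, z, y)`. [cite: ArtebaniDolgachev2009, §4 (the generator `g₀`)] -/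
theorem mulVec_g₀ (p : Fin 3 → K) : (𝐠₀ : Matrix (Fin 3) (Fin 3) K) *ᵥ p = ![p 0, p 2, p 1] := by
  funext i; fin_cases i <;> simp [Matrix.mulVec, dotProduct, Fin.sum_univ_three]

/-- `g₁ (x, y, z) = (y, z, x)` on coordinate vectors. [cite: ArtebaniDolgachev2009, §4 (the
generator `g₁`)] -/
theorem mulVec_g₁ (p : Fin 3 → K) : (𝐠₁ : Matrix (Fin 3) (Fin 3) K) *ᵥ p = ![p 1, p 2, p 0] := by
  funext i; fin_cases i <;> simp [Matrix.mulVec, dotProduct, Fin.sum_univ_three]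

/-- `t₃ (x, y, z) = (z, x, y)`. [cite: ArtebaniDolgachev2009, §4 (the generator `g₁`, inverted)] -/
theorem mulVec_t₃ (p : Fin 3 → K) : (𝐭₃ : Matrix (Fin 3) (Fin 3) K) *ᵥ p = ![p 2, p 0, p 1] := by
  funext i; fin_cases i <;> simp [Matrix.mulVec, dotProduct, Fin.sum_univ_three]

/-- `g₂ (x, y, z) = (x, ωy, ω²z)`. [cite: ArtebaniDolgachev2009, §4 (the generator `g₂`)] -/
theorem mulVec_g₂ (ω : K) (p : Fin 3 → K) :
    (𝐠₂[ω] : Matrix (Fin 3) (Fin 3) K) *ᵥ p = ![p 0, ω * p 1, ω ^ 2 * p 2] := by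
  funext i; fin_cases i <;> simp [Matrix.mulVec, dotProduct, Fin.sum_univ_three]

/-- `σ₁ (x, y, z) = (x, ω²z, ωy)`. [cite: ArtebaniDolgachev2009, §2 ("the third point of
intersection in `p̄q̄ ∩ E`")] -/
theorem mulVec_σ₁ (ω : K) (p : Fin 3 → K) :
    (𝛔₁[ω] : Matrix (Fin 3) (Fin 3) K) *ᵥ p = ![p 0, ω ^ 2 * p 2, ω * p 1] := by
  funext i; fin_cases i <;> simp [Matrix.mulVec, dotProduct, Fin.sum_univ_three]

/-- `σ₃ (x, y, z) = (z, y, x)`. [cite: ArtebaniDolgachev2009, §2 ("the third point of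
intersection in `p̄q̄ ∩ E`")] -/
theorem mulVec_σ₃ (p : Fin 3 → K) : (𝛔₃ : Matrix (Fin 3) (Fin 3) K) *ᵥ p = ![p 2, p 1, p 0] := by
  funext i; fin_cases i <;> simp [Matrix.mulVec, dotProduct, Fin.sum_univ_three]

/-- `t₃ = g₁²` (`= g₁⁻¹`, as `g₁³ = 1`, `HessePencilHessianGroup.g₀_sq_and_g₁_pow_three`), and the
two companions are involutions: `σ₁² = 1` (`ω³ = 1`), `σ₃² = 1`. [cite: ArtebaniDolgachev2009, §4
(`Γ = ⟨g₁, g₂⟩ ≅ (ℤ/3ℤ)²`)] -/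
theorem t₃_eq_g₁_sq_and_σ_sq {ω : K} (h3 : ω ^ 3 = 1) :
    (𝐭₃ : Matrix (Fin 3) (Fin 3) K) = 𝐠₁ * 𝐠₁ ∧ (𝛔₁[ω] : Matrix (Fin 3) (Fin 3) K) * 𝛔₁[ω] = 1 ∧
      (𝛔₃ : Matrix (Fin 3) (Fin 3) K) * 𝛔₃ = 1 := by
  refine ⟨?_, ?_, ?_⟩
  · ext i j : 1
    fin_cases i <;> fin_cases j <;> simp [Matrix.mul_apply, Fin.sum_univ_three]
  · ext i j : 1
    fin_cases i <;> fin_cases j <;> simp [Matrix.mul_apply, Fin.sum_univ_three] <;>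
      linear_combination h3
  · ext i j : 1
    fin_cases i <;> fin_cases j <;> simp [Matrix.mul_apply, Fin.sum_univ_three]

/-- `g₂³ = 1` on coordinate vectors: "Next time we repeat this procedure we get back to the
original point `p`" (`ω³ = 1`). [cite: ArtebaniDolgachev2009, §5 (proof of Prop. 5.2)] -/
theorem g₂_pow_three_mulVec {ω : K} (h3 : ω ^ 3 = 1) (p : Fin 3 → K) :
    (𝐠₂[ω] : Matrix (Fin 3) (Fin 3) K) *ᵥ ((𝐠₂[ω] : Matrix (Fin 3) (Fin 3) K) *ᵥ
      ((𝐠₂[ω] : Matrix (Fin 3) (Fin 3) K) *ᵥ p)) = p := by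
  have h6 : ω ^ 6 = 1 := by rw [show ω ^ 6 = (ω ^ 3) ^ 2 by ring, h3, one_pow]
  rw [mulVec_g₂, mulVec_g₂, mulVec_g₂]
  funext i; fin_cases i <;> simp
  · rw [show ω * (ω * (ω * p 1)) = ω ^ 3 * p 1 by ring, h3, one_mul]
  · rw [show ω ^ 2 * (ω ^ 2 * (ω ^ 2 * p 2)) = ω ^ 6 * p 2 by ring, h6, one_mul]

/-- **Every member is preserved by `g₀`** (pointwise form of `HessePencilHessianGroup.hesse_bind₁_g₀`):
`H_μ(g₀ p) = H_μ(p)`. [cite: ArtebaniDolgachev2009, §4 (the kernel `K ∋ g₀`)] -/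
theorem hesse_eval_mulVec_g₀ (μ : K) (p : Fin 3 → K) :
    eval ((𝐠₀ : Matrix (Fin 3) (Fin 3) K) *ᵥ p) 𝐇[μ] = eval p 𝐇[μ] := by
  rw [mulVec_g₀, hesse_eval, hesse_eval]; simp; ring

/-- **Every member is preserved by `g₂`** (`ω³ = 1`): `H_μ(g₂ p) = H_μ(p)` — "The point
`q = (x₀, εy₀, ε²z₀)` lies on `E` because `(x₀, y₀, z₀) ∈ E`". [cite: ArtebaniDolgachev2009, §5
(proof of Prop. 5.2)] -/
theorem hesse_eval_mulVec_g₂ (μ : K) {ω : K} (h3 : ω ^ 3 = 1) (p : Fin 3 → K) :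
    eval ((𝐠₂[ω] : Matrix (Fin 3) (Fin 3) K) *ᵥ p) 𝐇[μ] = eval p 𝐇[μ] := by
  have h6 : ω ^ 6 = 1 := by rw [show ω ^ 6 = (ω ^ 3) ^ 2 by ring, h3, one_pow]
  rw [mulVec_g₂, hesse_eval, hesse_eval]; simp
  linear_combination (p 1 ^ 3 - 3 * μ * p 0 * p 1 * p 2) * h3 + p 2 ^ 3 * h6

/-- Every member is preserved by `t₃`: `H_μ(t₃ p) = H_μ(p)`. [cite: ArtebaniDolgachev2009, §4 (the
kernel `K ∋ g₁`)] -/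
theorem hesse_eval_mulVec_t₃ (μ : K) (p : Fin 3 → K) :
    eval ((𝐭₃ : Matrix (Fin 3) (Fin 3) K) *ᵥ p) 𝐇[μ] = eval p 𝐇[μ] := by
  rw [mulVec_t₃, hesse_eval, hesse_eval]; simp; ring

/-- Every member is preserved by the companion `σ₁` (`ω³ = 1`): `H_μ(σ₁ p) = H_μ(p)`.
[cite: ArtebaniDolgachev2009, §4 (the Hessian group preserves the pencil)] -/
theorem hesse_eval_mulVec_σ₁ (μ : K) {ω : K} (h3 : ω ^ 3 = 1) (p : Fin 3 → K) :
    eval ((𝛔₁[ω] : Matrix (Fin 3) (Fin 3) K) *ᵥ p) 𝐇[μ] = eval p 𝐇[μ] := by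
  have h6 : ω ^ 6 = 1 := by rw [show ω ^ 6 = (ω ^ 3) ^ 2 by ring, h3, one_pow]
  rw [mulVec_σ₁, hesse_eval, hesse_eval]; simp
  linear_combination (p 1 ^ 3 - 3 * μ * p 0 * p 1 * p 2) * h3 + p 2 ^ 3 * h6

/-- Every member is preserved by the companion `σ₃`: `H_μ(σ₃ p) = H_μ(p)`.
[cite: ArtebaniDolgachev2009, §4 (the Hessian group preserves the pencil)] -/
theorem hesse_eval_mulVec_σ₃ (μ : K) (p : Fin 3 → K) :
    eval ((𝛔₃ : Matrix (Fin 3) (Fin 3) K) *ᵥ p) 𝐇[μ] = eval p 𝐇[μ] := by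
  rw [mulVec_σ₃, hesse_eval, hesse_eval]; simp; ring

/-! ## §1 `g₀` is the negation: `p₀, p, g₀ p` are collinear -/

/-- **`g₀ = (−1)` for the zero `p₀ = (0, 1, −1)`**: for every `p`, the three vectors
`p₀, p, g₀ p = (x, z, y)` are linearly dependent — "`−p`" is the third point of the line `p̄₀p̄`
(Cor. 10.7: `p₀ + p + (−p) = 0`). [cite: ArtebaniDolgachev2009, §2 (the group law with zero
`p₀`)] [cite: Kunz2005PlaneAlgebraicCurves, Ch. 10, Cor. 10.7] -/
theorem det_p₀_p_g₀ (p : Fin 3 → K) :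
    (Matrix.of ![![(0 : K), 1, -1], p, (𝐠₀ : Matrix (Fin 3) (Fin 3) K) *ᵥ p]).det = 0 := by
  rw [mulVec_g₀, Matrix.det_fin_three]; simp; ring

/-- The coincident case of §1: if `g₀ p` is proportional to `p ≠ 0`, then `y = z` or `p` is
proportional to `p₀`. [cite: ArtebaniDolgachev2009, §2 (the group law with zero `p₀`)] -/
theorem mulVec_g₀_eq_smul {p : Fin 3 → K} (hp : p ≠ 0) {c : K}
    (h : (𝐠₀ : Matrix (Fin 3) (Fin 3) K) *ᵥ p = c • p) :
    p 1 = p 2 ∨ ∃ d : K, p = d • ![(0 : K), 1, -1] := by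
  rw [mulVec_g₀] at h
  have e0 : p 0 = c * p 0 := by simpa using congrFun h 0
  have e1 : p 2 = c * p 1 := by simpa using congrFun h 1
  have e2 : p 1 = c * p 2 := by simpa using congrFun h 2
  by_cases hc : c = 1
  · left; rw [e2, hc, one_mul]
  · right
    have h0 : p 0 = 0 := by
      have : (c - 1) * p 0 = 0 := by linear_combination -e0
      exact (mul_eq_zero.1 this).resolve_left (sub_ne_zero.2 hc)
    have hcc : (c ^ 2 - 1) * p 1 = 0 := by linear_combination (-c) * e1 - e2
    have hp1 : p 1 ≠ 0 := by
      intro h1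
      apply hp
      have h2 : p 2 = 0 := by rw [e1, h1, mul_zero]
      funext i; fin_cases i
      · exact h0
      · exact h1
      · exact h2
    have hc2 : c ^ 2 = 1 := by
      have := (mul_eq_zero.1 hcc).resolve_right hp1
      linear_combination this
    have hc' : c = -1 := by
      have : (c - 1) * (c + 1) = 0 := by linear_combination hc2
      rcases mul_eq_zero.1 this with h' | h'
      · exact absurd (by linear_combination h') hc
      · linear_combination h'
    refine ⟨p 1, ?_⟩
    funext i; fin_cases i
    · simpa using h0
    · simp
    · simp; rw [e1, hc']; ring

/-- The tangency of the coincident case: if `y = z` then the tangent at `p` passes through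
`p₀` — `⟨∇H_μ(p), p₀⟩ = 3(y − z)(μx + y + z) = 0` (`HessePencilHarmonicPolars`, the harmonic polar
`Y = Z` of `p₀`): such `p` are the `2`-torsion points. [cite: ArtebaniDolgachev2009, §3 (the
points `q_j` whose tangent contains `p_i`)] -/
theorem hesse_grad_dotProduct_p₀_of_eq (μ : K) {p : Fin 3 → K} (h : p 1 = p 2) :
    (fun i => eval p (pderiv i 𝐇[μ])) ⬝ᵥ ![(0 : K), 1, -1] = 0 :=
  (hesse_tangent_through_basePoint₀ μ (w := (1 : K)) (one_pow 3) p).1 (by rw [h]; ring)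

/-! ## §2 `g₂` is the translation by `p₁`: the companion `σ₁` -/

/-- **"`g₂` [induces the translation] by the point `p₁`", first collinearity**: for every `p`,
the vectors `p, p₁ = (0, 1, −ω), σ₁ p = (x, ω²z, ωy)` are linearly dependent — `σ₁ p` is the
third point of the line `p̄p̄₁` (for every `p`; `ω³ = 1`). [cite: ArtebaniDolgachev2009, §4
("`g₂` that by the point `p₁`")] -/
theorem det_p_p₁_σ₁ {ω : K} (h3 : ω ^ 3 = 1) (p : Fin 3 → K) :
    (Matrix.of ![p, ![(0 : K), 1, -ω], (𝛔₁[ω] : Matrix (Fin 3) (Fin 3) K) *ᵥ p]).det = 0 := by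
  rw [mulVec_σ₁, Matrix.det_fin_three]; simp
  linear_combination (p 0 * p 2) * h3

/-- **"`g₂` [induces the translation] by the point `p₁`", second collinearity**: for every `p`,
the vectors `p₀ = (0, 1, −1), σ₁ p, g₂ p = (x, ωy, ω²z)` are linearly dependent — `g₂ p` is the
third point of the line through `p₀` and `σ₁ p`, i.e. `g₂ p = p ⊕ p₁` by the printed recipe.
[cite: ArtebaniDolgachev2009, §2 (the recipe for `p ⊕ q`), §4 ("`g₂` that by the point `p₁`")] -/
theorem det_p₀_σ₁_g₂ (ω : K) (p : Fin 3 → K) :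
    (Matrix.of ![![(0 : K), 1, -1], (𝛔₁[ω] : Matrix (Fin 3) (Fin 3) K) *ᵥ p,
      (𝐠₂[ω] : Matrix (Fin 3) (Fin 3) K) *ᵥ p]).det = 0 := by
  rw [mulVec_σ₁, mulVec_g₂, Matrix.det_fin_three]; simp; ring

/-- Where the base points go: `g₂ p₀ = ω·p₁`, `σ₁ p₀ = −ω²·p₂`, `σ₁ p₁ = −p₁` (`ω³ = 1`), so
`σ₁` fixes the point `p₁` and `g₂` moves the zero to `p₁`. [cite: ArtebaniDolgachev2009, §4
(`g₂` induces `σ₂ = (012)(345)(678)` on the base points)] -/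
theorem g₂_σ₁_mulVec_basePoints {ω : K} (h3 : ω ^ 3 = 1) :
    (𝐠₂[ω] : Matrix (Fin 3) (Fin 3) K) *ᵥ ![0, 1, -1] = ω • ![(0 : K), 1, -ω] ∧
      (𝛔₁[ω] : Matrix (Fin 3) (Fin 3) K) *ᵥ ![0, 1, -1] = (-ω ^ 2) • ![(0 : K), 1, -ω ^ 2] ∧
      (𝛔₁[ω] : Matrix (Fin 3) (Fin 3) K) *ᵥ ![0, 1, -ω] = (-1 : K) • ![(0 : K), 1, -ω] := by
  have h4 : ω ^ 4 = ω := by rw [show ω ^ 4 = ω ^ 3 * ω by ring, h3, one_mul]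
  refine ⟨?_, ?_, ?_⟩
  · rw [mulVec_g₂]; funext i; fin_cases i <;> simp; ring
  · rw [mulVec_σ₁]; funext i; fin_cases i <;> simp; linear_combination -h4
  · rw [mulVec_σ₁]; funext i; fin_cases i <;> simp; linear_combination h3

/-- The coincident case of the first line: if `σ₁ p` is proportional to `p ≠ 0` (`ω³ = 1`), then
`y = ω²z` (the harmonic polar of `p₁`) or `p` is proportional to `p₁`. [cite: ArtebaniDolgachev2009,
§3 (the harmonic polar `L_i` of `p_i`)] -/
theorem mulVec_σ₁_eq_smul {ω : K} (h3 : ω ^ 3 = 1) {p : Fin 3 → K} (hp : p ≠ 0) {c : K}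
    (h : (𝛔₁[ω] : Matrix (Fin 3) (Fin 3) K) *ᵥ p = c • p) :
    p 1 = ω ^ 2 * p 2 ∨ ∃ d : K, p = d • ![(0 : K), 1, -ω] := by
  have hω : ω ≠ 0 := fun h0 => by rw [h0] at h3; norm_num at h3
  rw [mulVec_σ₁] at h
  have e0 : p 0 = c * p 0 := by simpa using congrFun h 0
  have e1 : ω ^ 2 * p 2 = c * p 1 := by simpa using congrFun h 1
  have e2 : ω * p 1 = c * p 2 := by simpa using congrFun h 2
  by_cases hc : c = 1
  · left
    rw [hc, one_mul] at e1
    exact e1.symm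
  · right
    have h0 : p 0 = 0 := by
      have : (c - 1) * p 0 = 0 := by linear_combination -e0
      exact (mul_eq_zero.1 this).resolve_left (sub_ne_zero.2 hc)
    -- `ω³ p₁ p₂ = c² p₁ p₂`
    have hp2 : p 2 ≠ 0 := by
      intro h2
      apply hp
      have h1 : p 1 = 0 := by
        have : ω * p 1 = 0 := by rw [e2, h2, mul_zero]
        exact (mul_eq_zero.1 this).resolve_left hω
      funext i; fin_cases i
      · exact h0
      · exact h1
      · exact h2
    have hp1 : p 1 ≠ 0 := by
      intro h1
      have : ω ^ 2 * p 2 = 0 := by rw [e1, h1, mul_zero]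
      exact hp2 ((mul_eq_zero.1 this).resolve_left (pow_ne_zero 2 hω))
    have hc2 : c ^ 2 = 1 := by
      have key : (c ^ 2 - ω ^ 3) * (p 1 * p 2) = 0 := by
        linear_combination (-(c * p 1)) * e2 - (ω * p 1) * e1
      have := (mul_eq_zero.1 key).resolve_right (mul_ne_zero hp1 hp2)
      linear_combination this + h3
    have hc' : c = -1 := by
      have : (c - 1) * (c + 1) = 0 := by linear_combination hc2
      rcases mul_eq_zero.1 this with h' | h'
      · exact absurd (by linear_combination h') hc
      · linear_combination h'
    refine ⟨p 1, ?_⟩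
    funext i; fin_cases i
    · simpa using h0
    · simp
    · simp
      -- `ω p₁ = −p₂`, so `p₂ = −ω p₁`
      linear_combination e2 + p 2 * hc'

/-- The tangency of that case: on the harmonic polar `y = ω²z` of `p₁` the tangent passes through
`p₁`, `⟨∇H_μ(p), p₁⟩ = 0` (`ω³ = 1`; `HessePencilHarmonicPolars.hesse_tangent_through_basePoint₀`).
[cite: ArtebaniDolgachev2009, §3 (the points `q_j` whose tangent contains `p_i`)] -/
theorem hesse_grad_dotProduct_p₁_of_eq (μ : K) {ω : K} (h3 : ω ^ 3 = 1) {p : Fin 3 → K}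
    (h : p 1 = ω ^ 2 * p 2) :
    (fun i => eval p (pderiv i 𝐇[μ])) ⬝ᵥ ![(0 : K), 1, -ω] = 0 :=
  (hesse_tangent_through_basePoint₀ μ h3 p).1 h

/-- The coincident case of the second line: if `σ₁ p` is proportional to `g₂ p`, `p ≠ 0`
(`ω³ = 1`), then `y = ωz` or `p` is proportional to `p₂ = (0, 1, −ω²)`.
[cite: ArtebaniDolgachev2009, §2 (the recipe for `p ⊕ q`)] -/
theorem mulVec_σ₁_eq_smul_mulVec_g₂ {ω : K} (h3 : ω ^ 3 = 1) {p : Fin 3 → K} (hp : p ≠ 0) {c : K}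
    (h : (𝛔₁[ω] : Matrix (Fin 3) (Fin 3) K) *ᵥ p = c • ((𝐠₂[ω] : Matrix (Fin 3) (Fin 3) K) *ᵥ p)) :
    p 1 = ω * p 2 ∨ ∃ d : K, p = d • ![(0 : K), 1, -ω ^ 2] := by
  have hω : ω ≠ 0 := fun h0 => by rw [h0] at h3; norm_num at h3
  rw [mulVec_σ₁, mulVec_g₂] at h
  have e0 : p 0 = c * p 0 := by simpa using congrFun h 0
  have e1 : ω ^ 2 * p 2 = c * (ω * p 1) := by simpa using congrFun h 1
  have e2 : ω * p 1 = c * (ω ^ 2 * p 2) := by simpa using congrFun h 2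
  by_cases hc : c = 1
  · left
    rw [hc, one_mul] at e2
    have : ω * (p 1 - ω * p 2) = 0 := by linear_combination e2
    linear_combination (mul_eq_zero.1 this).resolve_left hω
  · right
    have h0 : p 0 = 0 := by
      have : (c - 1) * p 0 = 0 := by linear_combination -e0
      exact (mul_eq_zero.1 this).resolve_left (sub_ne_zero.2 hc)
    have hp2 : p 2 ≠ 0 := by
      intro h2
      apply hp
      have h1 : p 1 = 0 := by
        have : ω * p 1 = 0 := by rw [e2, h2]; ring
        exact (mul_eq_zero.1 this).resolve_left hω
      funext i; fin_cases i
      · exact h0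
      · exact h1
      · exact h2
    have hp1 : p 1 ≠ 0 := by
      intro h1
      have : ω ^ 2 * p 2 = 0 := by rw [e1, h1]; ring
      exact hp2 ((mul_eq_zero.1 this).resolve_left (pow_ne_zero 2 hω))
    have hc2 : c ^ 2 = 1 := by
      have key : (c ^ 2 - 1) * (ω ^ 3 * (p 1 * p 2)) = 0 := by
        linear_combination (-(c * (ω ^ 2 * p 2))) * e1 - (ω ^ 2 * p 2) * e2
      have hne : ω ^ 3 * (p 1 * p 2) ≠ 0 := mul_ne_zero (pow_ne_zero 3 hω) (mul_ne_zero hp1 hp2)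
      have := (mul_eq_zero.1 key).resolve_right hne
      linear_combination this
    have hc' : c = -1 := by
      have : (c - 1) * (c + 1) = 0 := by linear_combination hc2
      rcases mul_eq_zero.1 this with h' | h'
      · exact absurd (by linear_combination h') hc
      · linear_combination h'
    refine ⟨p 1, ?_⟩
    funext i; fin_cases i
    · simpa using h0
    · simp
    · simp
      -- `ω p₁ = −ω² p₂`, so `p₂ = −ω² p₁` (using `ω³ = 1`)
      have e2' : ω * p 1 = -(ω ^ 2 * p 2) := by rw [e2, hc']; ring
      linear_combination ω * e2' - p 2 * h3

/-- The tangency of that case: if `y = ωz` then `σ₁ p = (x, ω²z, ω²z)` lies on the harmonic polar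
`Y = Z` of `p₀`, so the tangent at `σ₁ p` passes through `p₀`: `⟨∇H_μ(σ₁ p), p₀⟩ = 0`.
[cite: ArtebaniDolgachev2009, §3 (the points `q_j` whose tangent contains `p_i`)] -/
theorem hesse_grad_σ₁_dotProduct_p₀_of_eq (μ ω : K) {p : Fin 3 → K} (h : p 1 = ω * p 2) :
    (fun i => eval ((𝛔₁[ω] : Matrix (Fin 3) (Fin 3) K) *ᵥ p) (pderiv i 𝐇[μ])) ⬝ᵥ
      ![(0 : K), 1, -1] = 0 := by
  refine hesse_grad_dotProduct_p₀_of_eq μ ?_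
  rw [mulVec_σ₁]; simp; rw [h]; ring

/-! ## §3 `t₃ = g₁⁻¹` is the translation by `p₃`: the companion `σ₃` -/

/-- **"`g₁` induces the translation by the 3-torsion point `p₃`"** (for the point map
`t₃ = g₁⁻¹ = (z, x, y)`), first collinearity: `p, p₃ = (1, 0, −1), σ₃ p = (z, y, x)` are linearly
dependent for every `p`. [cite: ArtebaniDolgachev2009, §4 ("`g₁` induces the translation by the
3-torsion point `p₃`")] -/
theorem det_p_p₃_σ₃ (p : Fin 3 → K) :
    (Matrix.of ![p, ![(1 : K), 0, -1], (𝛔₃ : Matrix (Fin 3) (Fin 3) K) *ᵥ p]).det = 0 := by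
  rw [mulVec_σ₃, Matrix.det_fin_three]; simp; ring

/-- Second collinearity for `t₃`: `p₀, σ₃ p = (z, y, x), t₃ p = (z, x, y)` are linearly dependent
for every `p` — `t₃ p = p ⊕ p₃` by the printed recipe. [cite: ArtebaniDolgachev2009, §2 (the
recipe for `p ⊕ q`), §4 ("the translation by the 3-torsion point `p₃`")] -/
theorem det_p₀_σ₃_t₃ (p : Fin 3 → K) :
    (Matrix.of ![![(0 : K), 1, -1], (𝛔₃ : Matrix (Fin 3) (Fin 3) K) *ᵥ p,
      (𝐭₃ : Matrix (Fin 3) (Fin 3) K) *ᵥ p]).det = 0 := by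
  rw [mulVec_σ₃, mulVec_t₃, Matrix.det_fin_three]; simp; ring

/-- Where the base points go: `t₃ p₀ = −p₃`, `σ₃ p₀ = −p₆` (`p₆ = (1, −1, 0)`), `σ₃ p₃ = −p₃`,
and `g₁ p₀ = p₆` (the printed `g₁` moves the zero to `p₆ = −p₃`, its inverse `t₃` to `p₃`).
[cite: ArtebaniDolgachev2009, §4 (`g₁` induces `σ₁ = (063)(174)(285)` on the base points)] -/
theorem t₃_σ₃_mulVec_basePoints :
    (𝐭₃ : Matrix (Fin 3) (Fin 3) K) *ᵥ ![0, 1, -1] = (-1 : K) • ![(1 : K), 0, -1] ∧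
      (𝛔₃ : Matrix (Fin 3) (Fin 3) K) *ᵥ ![0, 1, -1] = (-1 : K) • ![(1 : K), -1, 0] ∧
      (𝛔₃ : Matrix (Fin 3) (Fin 3) K) *ᵥ ![1, 0, -1] = (-1 : K) • ![(1 : K), 0, -1] ∧
      (𝐠₁ : Matrix (Fin 3) (Fin 3) K) *ᵥ ![0, 1, -1] = ![(1 : K), -1, 0] := by
  refine ⟨?_, ?_, ?_, ?_⟩
  · rw [mulVec_t₃]; funext i; fin_cases i <;> simp
  · rw [mulVec_σ₃]; funext i; fin_cases i <;> simp
  · rw [mulVec_σ₃]; funext i; fin_cases i <;> simp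
  · rw [mulVec_g₁]; funext i; fin_cases i <;> simp

/-- The coincident case of the first line: if `σ₃ p` is proportional to `p ≠ 0` then `x = z`
(the harmonic polar of `p₃`) or `p` is proportional to `p₃`. [cite: ArtebaniDolgachev2009, §3
(the harmonic polar `L_i` of `p_i`)] -/
theorem mulVec_σ₃_eq_smul {p : Fin 3 → K} (hp : p ≠ 0) {c : K}
    (h : (𝛔₃ : Matrix (Fin 3) (Fin 3) K) *ᵥ p = c • p) :
    p 0 = p 2 ∨ ∃ d : K, p = d • ![(1 : K), 0, -1] := by
  rw [mulVec_σ₃] at h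
  have e0 : p 2 = c * p 0 := by simpa using congrFun h 0
  have e1 : p 1 = c * p 1 := by simpa using congrFun h 1
  have e2 : p 0 = c * p 2 := by simpa using congrFun h 2
  by_cases hc : c = 1
  · left; rw [e2, hc, one_mul]
  · right
    have h1 : p 1 = 0 := by
      have : (c - 1) * p 1 = 0 := by linear_combination -e1
      exact (mul_eq_zero.1 this).resolve_left (sub_ne_zero.2 hc)
    have hp0 : p 0 ≠ 0 := by
      intro h0
      apply hp
      have h2 : p 2 = 0 := by rw [e0, h0, mul_zero]
      funext i; fin_cases i
      · exact h0
      · exact h1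
      · exact h2
    have hc2 : c ^ 2 = 1 := by
      have key : (c ^ 2 - 1) * p 0 = 0 := by linear_combination (-c) * e0 - e2
      have := (mul_eq_zero.1 key).resolve_right hp0
      linear_combination this
    have hc' : c = -1 := by
      have : (c - 1) * (c + 1) = 0 := by linear_combination hc2
      rcases mul_eq_zero.1 this with h' | h'
      · exact absurd (by linear_combination h') hc
      · linear_combination h'
    refine ⟨p 0, ?_⟩
    funext i; fin_cases i
    · simp
    · simpa using h1
    · simp; rw [e0, hc']; ring

/-- The tangency of that case: on the harmonic polar `x = z` of `p₃` the tangent passes through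
`p₃`: `⟨∇H_μ(p), p₃⟩ = 3(x − z)(x + μy + z) = 0`
(`HessePencilHarmonicPolars.hesse_tangent_through_basePoint₁` at `w = 1`).
[cite: ArtebaniDolgachev2009, §3 (the points `q_j` whose tangent contains `p_i`)] -/
theorem hesse_grad_dotProduct_p₃_of_eq (μ : K) {p : Fin 3 → K} (h : p 0 = p 2) :
    (fun i => eval p (pderiv i 𝐇[μ])) ⬝ᵥ ![(1 : K), 0, -1] = 0 :=
  (hesse_tangent_through_basePoint₁ μ (w := (1 : K)) (one_pow 3) p).1 (by rw [h]; ring)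

/-- The coincident case of the second line: if `σ₃ p` is proportional to `t₃ p`, `p ≠ 0`, then
`x = y` or `p` is proportional to `p₆ = (1, −1, 0)`. [cite: ArtebaniDolgachev2009, §2 (the recipe
for `p ⊕ q`)] -/
theorem mulVec_σ₃_eq_smul_mulVec_t₃ {p : Fin 3 → K} (hp : p ≠ 0) {c : K}
    (h : (𝛔₃ : Matrix (Fin 3) (Fin 3) K) *ᵥ p = c • ((𝐭₃ : Matrix (Fin 3) (Fin 3) K) *ᵥ p)) :
    p 0 = p 1 ∨ ∃ d : K, p = d • ![(1 : K), -1, 0] := by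
  rw [mulVec_σ₃, mulVec_t₃] at h
  have e0 : p 2 = c * p 2 := by simpa using congrFun h 0
  have e1 : p 1 = c * p 0 := by simpa using congrFun h 1
  have e2 : p 0 = c * p 1 := by simpa using congrFun h 2
  by_cases hc : c = 1
  · left; rw [e2, hc, one_mul]
  · right
    have h2 : p 2 = 0 := by
      have : (c - 1) * p 2 = 0 := by linear_combination -e0
      exact (mul_eq_zero.1 this).resolve_left (sub_ne_zero.2 hc)
    have hp0 : p 0 ≠ 0 := by
      intro h0
      apply hp
      have h1 : p 1 = 0 := by rw [e1, h0, mul_zero]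
      funext i; fin_cases i
      · exact h0
      · exact h1
      · exact h2
    have hc2 : c ^ 2 = 1 := by
      have key : (c ^ 2 - 1) * p 0 = 0 := by linear_combination (-c) * e1 - e2
      have := (mul_eq_zero.1 key).resolve_right hp0
      linear_combination this
    have hc' : c = -1 := by
      have : (c - 1) * (c + 1) = 0 := by linear_combination hc2
      rcases mul_eq_zero.1 this with h' | h'
      · exact absurd (by linear_combination h') hc
      · linear_combination h'
    refine ⟨p 0, ?_⟩
    funext i; fin_cases i
    · simp
    · simp; rw [e1, hc']; ring
    · simpa using h2

/-- The tangency of that case: if `x = y` then `σ₃ p = (z, y, x)` lies on the harmonic polar `Y = Z`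
of `p₀`, so `⟨∇H_μ(σ₃ p), p₀⟩ = 0`. [cite: ArtebaniDolgachev2009, §3 (the points `q_j` whose
tangent contains `p_i`)] -/
theorem hesse_grad_σ₃_dotProduct_p₀_of_eq (μ : K) {p : Fin 3 → K} (h : p 0 = p 1) :
    (fun i => eval ((𝛔₃ : Matrix (Fin 3) (Fin 3) K) *ᵥ p) (pderiv i 𝐇[μ])) ⬝ᵥ
      ![(0 : K), 1, -1] = 0 := by
  refine hesse_grad_dotProduct_p₀_of_eq μ ?_
  rw [mulVec_σ₃]; simp; rw [h]

/-! ## §4 The inflection tangents at `p₀, p₁, p₃` meet a smooth member only at the base point -/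

/-- **The tangent at the base point `p₁ = (0, 1, −ω)` meets a smooth member only at `p₁`**
(`ω³ = 1`, `3 ≠ 0`, `μ³ ≠ 1`): the tangent there is `μωX + Y + ω²Z = 0`
(`HessePencilHarmonicPolars.hesse_grad_basePoint₀`), and on it `H_μ = (1 − μ³)X³`; so a point `q`
of `H_μ` with `⟨∇H_μ(p₁), q⟩ = 0` is a multiple of `p₁` (`p₁` is a flex: the intersection
multiplicity is `3`, whence `3p₁ = 0`). [cite: ArtebaniDolgachev2009, §2 ("they are the
inflection points of any smooth curve in the pencil")] -/
theorem hesse_inflectionTangent_meets_only_p₁ (h3K : (3 : K) ≠ 0) {μ : K} (hμ : μ ^ 3 ≠ 1) {ω : K}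
    (h3 : ω ^ 3 = 1) {q : Fin 3 → K} (hq : eval q 𝐇[μ] = 0)
    (ht : (fun i => eval ![(0 : K), 1, -ω] (pderiv i 𝐇[μ])) ⬝ᵥ q = 0) :
    ∃ c : K, q = c • ![(0 : K), 1, -ω] := by
  have hg := (hesse_grad_basePoint₀ μ h3 (1 : K)).2
  rw [one_smul] at hg
  rw [hg] at ht
  simp [dotProduct, Fin.sum_univ_three] at ht
  -- the tangent line: `μω q₀ + q₁ + ω² q₂ = 0`
  have hl : μ * ω * q 0 + q 1 + ω ^ 2 * q 2 = 0 := by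
    have : (3 : K) * (μ * ω * q 0 + q 1 + ω ^ 2 * q 2) = 0 := by linear_combination ht
    exact (mul_eq_zero.1 this).resolve_left h3K
  rw [hesse_eval] at hq
  have hq1 : q 1 = -(μ * ω * q 0) - ω ^ 2 * q 2 := by linear_combination hl
  -- on the line, `H_μ = (1 − μ³) q₀³`
  have key : (1 - μ ^ 3) * q 0 ^ 3 = 0 := by
    rw [hq1] at hq
    linear_combination hq + (3 * ω * μ ^ 2 * q 0 ^ 2 * q 2 + 3 * ω ^ 2 * μ * q 0 * q 2 ^ 2 +
      ω ^ 3 * q 2 ^ 3 + μ ^ 3 * q 0 ^ 3 + q 2 ^ 3) * h3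
  have hq0 : q 0 = 0 := by
    rcases mul_eq_zero.1 key with h | h
    · exact absurd (by linear_combination -h) hμ
    · exact (pow_eq_zero_iff three_ne_zero).1 h
  refine ⟨q 1, ?_⟩
  funext i; fin_cases i
  · simpa using hq0
  · simp
  · simp
    rw [hq0] at hq1
    -- `q₁ = −ω² q₂`, so `q₂ = −ω q₁`
    linear_combination ω * hq1 - q 2 * h3

/-- **The tangent at `p₀ = (0, 1, −1)` meets a smooth member only at `p₀`** (`3 ≠ 0`, `μ³ ≠ 1`):
the case `ω = 1` of `hesse_inflectionTangent_meets_only_p₁` (tangent `μX + Y + Z = 0`, on it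
`H_μ = (1 − μ³)X³`). [cite: ArtebaniDolgachev2009, §2 ("they are the inflection points of any
smooth curve in the pencil")] -/
theorem hesse_inflectionTangent_meets_only_p₀ (h3K : (3 : K) ≠ 0) {μ : K} (hμ : μ ^ 3 ≠ 1) {q : Fin 3 → K}
    (hq : eval q 𝐇[μ] = 0) (ht : (fun i => eval ![(0 : K), 1, -1] (pderiv i 𝐇[μ])) ⬝ᵥ q = 0) :
    ∃ c : K, q = c • ![(0 : K), 1, -1] := by
  have h := hesse_inflectionTangent_meets_only_p₁ h3K hμ (ω := (1 : K)) (one_pow 3) hq (by simpa using ht)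
  simpa using h

/-- **The tangent at `p₃ = (1, 0, −1)` meets a smooth member only at `p₃`** (`3 ≠ 0`, `μ³ ≠ 1`):
the tangent there is `X + μY + Z = 0` (`hesse_grad_basePoint₁`), and on it `H_μ = (1 − μ³)Y³`.
[cite: ArtebaniDolgachev2009, §2 ("they are the inflection points of any smooth curve in the
pencil")] -/
theorem hesse_inflectionTangent_meets_only_p₃ (h3K : (3 : K) ≠ 0) {μ : K} (hμ : μ ^ 3 ≠ 1) {q : Fin 3 → K}
    (hq : eval q 𝐇[μ] = 0) (ht : (fun i => eval ![(1 : K), 0, -1] (pderiv i 𝐇[μ])) ⬝ᵥ q = 0) :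
    ∃ c : K, q = c • ![(1 : K), 0, -1] := by
  have hg := (hesse_grad_basePoint₁ μ (w := (1 : K)) (one_pow 3) (1 : K)).2
  rw [one_smul] at hg
  rw [hg] at ht
  simp [dotProduct, Fin.sum_univ_three] at ht
  have hl : q 0 + μ * q 1 + q 2 = 0 := by
    have : (3 : K) * (q 0 + μ * q 1 + q 2) = 0 := by linear_combination ht
    exact (mul_eq_zero.1 this).resolve_left h3K
  rw [hesse_eval] at hq
  have hq0 : q 0 = -(μ * q 1) - q 2 := by linear_combination hl
  have key : (1 - μ ^ 3) * q 1 ^ 3 = 0 := by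
    rw [hq0] at hq
    linear_combination hq
  have hq1 : q 1 = 0 := by
    rcases mul_eq_zero.1 key with h | h
    · exact absurd (by linear_combination -h) hμ
    · exact (pow_eq_zero_iff three_ne_zero).1 h
  refine ⟨q 0, ?_⟩
  funext i; fin_cases i
  · simp
  · simpa using hq1
  · simp
    rw [hq1] at hq0
    linear_combination hq0

/-! ## §5 The tangent at `p` and the translates of `p`: the eight cubics `B₁, …, B₈` -/

/-- **"The point `q = (x₀, εy₀, ε²z₀)` … also lies on the tangent line at `p` if
`p = (x₀, y₀, z₀)` satisfies the equation `B₁ : x³ + εy³ + ε²z³ = 0`"** — in fact identically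
(`ω² + ω + 1 = 0`): `⟨∇H_μ(p), g₂ p⟩ = 3·B₁(p)` for every `p`, the term `tx₀y₀z₀(1 + ε + ε²)`
dropping out. [cite: ArtebaniDolgachev2009, §5 (proof of Prop. 5.2)] -/
theorem hesse_grad_dotProduct_g₂ (μ : K) {ω : K} (hω : ω ^ 2 + ω + 1 = 0) (p : Fin 3 → K) :
    (fun i => eval p (pderiv i 𝐇[μ])) ⬝ᵥ ((𝐠₂[ω] : Matrix (Fin 3) (Fin 3) K) *ᵥ p) =
      3 * eval p 𝐁₁[ω] := by
  rw [hesse_eval_pderiv, mulVec_g₂]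
  simp [dotProduct, Fin.sum_univ_three]
  linear_combination (-(3 * μ * p 0 * p 1 * p 2)) * hω

/-- **"If `p` satisfies this equation, then `q` also satisfies this equation"**: `B₁(g₂ p) = B₁(p)`
(`ω³ = 1`). [cite: ArtebaniDolgachev2009, §5 (proof of Prop. 5.2)] -/
theorem B₁_eval_mulVec_g₂ {ω : K} (h3 : ω ^ 3 = 1) (p : Fin 3 → K) :
    eval ((𝐠₂[ω] : Matrix (Fin 3) (Fin 3) K) *ᵥ p) 𝐁₁[ω] = eval p 𝐁₁[ω] := by
  have h6 : ω ^ 6 = 1 := by rw [show ω ^ 6 = (ω ^ 3) ^ 2 by ring, h3, one_pow]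
  rw [mulVec_g₂]; simp
  linear_combination ω * p 1 ^ 3 * h3 + ω ^ 2 * p 2 ^ 3 * h6

/-- **"hence `r = (x₀, ε²y₀, εz₀)` lies on the tangent at `q`"**: with `q = g₂ p` and `r = g₂ q`,
`⟨∇H_μ(q), r⟩ = 3·B₁(q) = 3·B₁(p)` (`ω² + ω + 1 = 0`), and `r = g₂² p = (x₀, ω²y₀, ω⁴z₀) =
(x₀, ω²y₀, ωz₀)`. [cite: ArtebaniDolgachev2009, §5 (proof of Prop. 5.2)] -/
theorem hesse_grad_g₂_dotProduct_g₂_sq (μ : K) {ω : K} (hω : ω ^ 2 + ω + 1 = 0) (p : Fin 3 → K) :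
    (fun i => eval ((𝐠₂[ω] : Matrix (Fin 3) (Fin 3) K) *ᵥ p) (pderiv i 𝐇[μ])) ⬝ᵥ
        ((𝐠₂[ω] : Matrix (Fin 3) (Fin 3) K) *ᵥ ((𝐠₂[ω] : Matrix (Fin 3) (Fin 3) K) *ᵥ p)) =
      3 * eval p 𝐁₁[ω] ∧
    (𝐠₂[ω] : Matrix (Fin 3) (Fin 3) K) *ᵥ ((𝐠₂[ω] : Matrix (Fin 3) (Fin 3) K) *ᵥ p) =
      ![p 0, ω ^ 2 * p 1, ω * p 2] := by
  have h3 : ω ^ 3 = 1 := by linear_combination (ω - 1) * hω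
  have h4 : ω ^ 4 = ω := by rw [show ω ^ 4 = ω ^ 3 * ω by ring, h3, one_mul]
  refine ⟨by rw [hesse_grad_dotProduct_g₂ μ hω, B₁_eval_mulVec_g₂ h3], ?_⟩
  rw [mulVec_g₂, mulVec_g₂]
  funext i; fin_cases i <;> simp
  · ring
  · linear_combination p 2 * h4

/-- **The eight cubics of Prop. 5.2 as the eight non-trivial translations** (`ω² + ω + 1 = 0`):
for every `p`, writing the translates `g₂^a t₃^b p` out,
`⟨∇H_μ(p), (x, ωy, ω²z)⟩ = 3·B₁(p)`, `⟨∇H_μ(p), (x, ω²y, ωz)⟩ = 3·B₅(p)`,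
`⟨∇H_μ(p), (z, x, y)⟩ = 3(1 − μ)·B₆(p)`, `⟨∇H_μ(p), (y, z, x)⟩ = 3(1 − μ)·B₂(p)`,
`⟨∇H_μ(p), (z, ωx, ω²y)⟩ = 3(1 − ωμ)·B₇(p)`, `⟨∇H_μ(p), (z, ω²x, ωy)⟩ = 3(1 − ω²μ)·B₈(p)`,
`⟨∇H_μ(p), (y, ωz, ω²x)⟩ = 3(1 − ω²μ)·B₄(p)`, `⟨∇H_μ(p), (y, ω²z, ωx)⟩ = 3(1 − ωμ)·B₃(p)`,
with `B₁ = x³ + εy³ + ε²z³`, `B₅ = x³ + ε²y³ + εz³`, `B₂ = x²y + y²z + z²x`,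
`B₆ = x²z + y²x + z²y`, `B₃ = x²y + ε²y²z + εz²x`, `B₇ = x²z + εy²x + ε²z²y`,
`B₄ = x²y + εy²z + ε²z²x`, `B₈ = x²z + ε²y²x + εz²y` as printed — so the tangent at a point `p`
of a smooth member (`μ ∉ {1, ω, ω²}`) passes through the translate of `p` by a non-zero base point
iff `p` lies on the corresponding cubic `Bᵢ`. [cite: ArtebaniDolgachev2009, §5 (Prop. 5.2 and
its proof: "we apply the elements of the Hessian group to the curve `B₁` to get the remaining
cubic curves")] -/
theorem hesse_grad_dotProduct_translations (μ : K) {ω : K} (hω : ω ^ 2 + ω + 1 = 0)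
    (p : Fin 3 → K) :
    (fun i => eval p (pderiv i 𝐇[μ])) ⬝ᵥ ![p 0, ω * p 1, ω ^ 2 * p 2] =
        3 * (p 0 ^ 3 + ω * p 1 ^ 3 + ω ^ 2 * p 2 ^ 3) ∧
      (fun i => eval p (pderiv i 𝐇[μ])) ⬝ᵥ ![p 0, ω ^ 2 * p 1, ω * p 2] =
        3 * (p 0 ^ 3 + ω ^ 2 * p 1 ^ 3 + ω * p 2 ^ 3) ∧
      (fun i => eval p (pderiv i 𝐇[μ])) ⬝ᵥ ![p 2, p 0, p 1] =
        3 * (1 - μ) * (p 0 ^ 2 * p 2 + p 1 ^ 2 * p 0 + p 2 ^ 2 * p 1) ∧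
      (fun i => eval p (pderiv i 𝐇[μ])) ⬝ᵥ ![p 1, p 2, p 0] =
        3 * (1 - μ) * (p 0 ^ 2 * p 1 + p 1 ^ 2 * p 2 + p 2 ^ 2 * p 0) ∧
      (fun i => eval p (pderiv i 𝐇[μ])) ⬝ᵥ ![p 2, ω * p 0, ω ^ 2 * p 1] =
        3 * (1 - ω * μ) * (p 0 ^ 2 * p 2 + ω * p 1 ^ 2 * p 0 + ω ^ 2 * p 2 ^ 2 * p 1) ∧
      (fun i => eval p (pderiv i 𝐇[μ])) ⬝ᵥ ![p 2, ω ^ 2 * p 0, ω * p 1] =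
        3 * (1 - ω ^ 2 * μ) * (p 0 ^ 2 * p 2 + ω ^ 2 * p 1 ^ 2 * p 0 + ω * p 2 ^ 2 * p 1) ∧
      (fun i => eval p (pderiv i 𝐇[μ])) ⬝ᵥ ![p 1, ω * p 2, ω ^ 2 * p 0] =
        3 * (1 - ω ^ 2 * μ) * (p 0 ^ 2 * p 1 + ω * p 1 ^ 2 * p 2 + ω ^ 2 * p 2 ^ 2 * p 0) ∧
      (fun i => eval p (pderiv i 𝐇[μ])) ⬝ᵥ ![p 1, ω ^ 2 * p 2, ω * p 0] =
        3 * (1 - ω * μ) * (p 0 ^ 2 * p 1 + ω ^ 2 * p 1 ^ 2 * p 2 + ω * p 2 ^ 2 * p 0) := by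
  rw [hesse_eval_pderiv]
  simp [dotProduct, Fin.sum_univ_three]
  refine ⟨?_, ?_, ?_, ?_, ?_, ?_, ?_, ?_⟩
  · linear_combination (-(3 * μ * p 0 * p 1 * p 2)) * hω
  · linear_combination (-(3 * μ * p 0 * p 1 * p 2)) * hω
  · ring
  · ring
  · linear_combination (3 * ω * μ * p 1 * p 2 ^ 2 - 3 * μ * p 1 * p 2 ^ 2) * hω
  · linear_combination (3 * ω ^ 2 * μ * p 0 * p 1 ^ 2 - 3 * ω * μ * p 0 * p 1 ^ 2 +
      3 * ω * μ * p 1 * p 2 ^ 2 - 3 * μ * p 1 * p 2 ^ 2) * hω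
  · linear_combination (3 * ω ^ 2 * μ * p 0 * p 2 ^ 2 - 3 * ω * μ * p 0 * p 2 ^ 2 +
      3 * ω * μ * p 1 ^ 2 * p 2 - 3 * μ * p 1 ^ 2 * p 2) * hω
  · linear_combination (3 * ω * μ * p 1 ^ 2 * p 2 - 3 * μ * p 1 ^ 2 * p 2) * hω

/-- The constants of `hesse_grad_dotProduct_translations` do not vanish on a smooth member:
`μ³ ≠ 1` and `ω³ = 1` give `1 − μ ≠ 0`, `1 − ωμ ≠ 0`, `1 − ω²μ ≠ 0`. [cite: ArtebaniDolgachev2009,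
§2 (the singular members are `μ³ = 1` and `E_∞`)] -/
theorem translation_constants_ne_zero {μ : K} (hμ : μ ^ 3 ≠ 1) {ω : K} (h3 : ω ^ 3 = 1) :
    1 - μ ≠ 0 ∧ 1 - ω * μ ≠ 0 ∧ 1 - ω ^ 2 * μ ≠ 0 := by
  have h6 : ω ^ 6 = 1 := by rw [show ω ^ 6 = (ω ^ 3) ^ 2 by ring, h3, one_pow]
  refine ⟨fun h => hμ ?_, fun h => hμ ?_, fun h => hμ ?_⟩
  · have : μ = 1 := by linear_combination -h
    rw [this, one_pow]
  · have hμω : ω * μ = 1 := by linear_combination -h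
    calc μ ^ 3 = ω ^ 3 * μ ^ 3 := by rw [h3, one_mul]
      _ = (ω * μ) ^ 3 := by ring
      _ = 1 := by rw [hμω, one_pow]
  · have hμω : ω ^ 2 * μ = 1 := by linear_combination -h
    calc μ ^ 3 = ω ^ 6 * μ ^ 3 := by rw [h6, one_mul]
      _ = (ω ^ 2 * μ) ^ 3 := by ring
      _ = 1 := by rw [hμω, one_pow]

end TranslationIncidences

end Literature.AlgebraicGeometry.PlaneCurves
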